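import Mathlib.Analysis.Calculus.Deriv.Polynomial
import Mathlib.Analysis.SpecialFunctions.Integrals.Basic
import Mathlib.MeasureTheory.Integral.IntervalIntegral.FundThmCalculus
import Mathlib.Topology.Algebra.Polynomial
import HarnessLib

/-!
# The main-term forms of the mollified first and second moments in the harmonic family
# `S₂(q)*` (Kowalski–Michel–VanderKam 2000, §6: (30)–(33) and Theorem 6.1)

Topic `Literature/NumberTheory/LFunctions` (namespace `Literature.NumberTheory.LFunctions.KMV2000`,
a grouping sub-namespace naming the paper). Typed for the LANDAU–SIEGEL PROGRAMME (cell
`landau-siegel`, rung F-S3, sub-cell §B-fam = the Iwaniec–Sarnak `GL(2)`-family route), as the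
definition request **D-fam-1** of the cell's OBJECTIVE.md §3.4: "the IS-family mollified first /
second moment MAIN-TERM FUNCTIONALS `L₁(d)`, `Q₂(d)`" whose Cauchy–Schwarz ratio
`𝔭(d) = L₁(d)² / Q₂(d)` is the main-order non-vanishing proportion the family's objective
`OBJ_fam(d) = ½ − 𝔭(d)` is built from. Everything in this file is a REAL definition with a body or a
PROVED theorem about those definitions; NO named fact (`def … : Prop`) is introduced (D-0026). The
family-level asymptotics that these forms are the main terms OF (Propositions 4.1, 5.1 and
Theorems 1.6 / 6.1 of the source, harmonic family `S₂(q)*`, `q` prime, mollifier length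
`M = q̂^Δ`, `0 < Δ < 1`) are typed separately as named facts over the tree's family vocabulary
(`Literature.NumberTheory.LFunctions.IwaniecSarnak.*`); this file is their profile calculus.

FRAMING (cell rule): the programme SEARCHES and TYPES; nothing here is a claim about Landau–Siegel
zeros.

## Source, read on the page (held text `paper:doi-10-1515-crll-2000-074`, 2026-08-26)

E. Kowalski, P. Michel, J. VanderKam, *Non-vanishing of high derivatives of automorphic
`L`-functions at the center of the critical strip*, J. reine angew. Math. **526** (2000) 1–34
[KowalskiMichelVanderKam2000]. Setting (§1–§2, pp. 1–7): `q` prime, `S₂(q)*` the primitive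
weight-2 forms of level `q`, `λ_f(1) = 1`, `Λ(f,s) = q̂^s Γ(s+½) L(f,s)`, `q̂ = √q/2π`,
`Λ(f,s) = ε_f Λ(f,1−s)`; harmonic weights `ω_f = 1/4π(f,f)`, `Σ^h_f α_f = Σ_f ω_f α_f`,
`Σ^h 1 = 1 + O(q^{−3/2})` (4); mollifier (9)
`M_P(f) = Σ_{m<M} λ_f(m) μ(m) ψ(m)^{−1} m^{−1/2} P(log(M/m)/log M)`, `ψ(m) = ∏_{p∣m}(1+1/p)`,
`M = q̂^Δ`, "`P` a polynomial which satisfies `P(0) = P′(0) = 0`"; mollified moments (6)–(7)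
`L^h = Σ^h Λ^{(k)}(f,½) M(f)`, `Q^h = Σ^h |Λ^{(k)}(f,½) M(f)|²`, and "Hence
`Σ^h_{Λ^{(k)}(f,½) ≠ 0} 1 ≥ L(x)²/Q(x)`" (p. 6).

* **(30)** (p. 18; `Q(y) = y^k`, `Δ = log M / log q̂`):
  `L^h(P) = (1 + O_Q(1/log q)) ζ(2) q̂^{1/2} ((log q̂)^{k−1}/Δ) · (Q(1)P′(1) + ΔQ′(1)P(1))`.
* **(31)** (p. 19): `Q^h(P) = (1 + O_Q(1/log q)) 2q̂ ζ(2)² ((log q̂)^{2k−2}/Δ²) ×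
  [ (Q(1)P′(1) + ΔQ′(1)P(1))² + Δ^{−1} ∫∫_{[0,1]²} (P″(x)Q(y) − Δ²P(x)Q″(y))² dx dy ]`,
  obtained from Proposition 5.1 by "Remarking the equalities `∫₀¹(P′(x)² + (PP″)(x))dx = P(1)P′(1)`,
  `∫₀¹(Q′(x)² + (QQ″)(x))dx = Q(1)Q′(1)`"; and (p. 19) the same two displays hold for the
  generalized moments `L^h(P,Q)`, `Q^h(P,Q)` of `Q̃(Λ(f,s))(½)`, `Q̃ = Q((log q̂)^{−1}∂_s)`,
  "as soon as `Q` is either an odd or an even polynomial".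
* **Theorem 6.1** (p. 20): "Let `Q` be a fixed polynomial which is either odd or even. Then as
  `q → +∞` we have
  `liminf Σ^h_{f : Q̃(Λ(f,s))(½) ≠ 0} 1 ≥ Max_{P,Δ} R(P,Q) = Max_{P,Δ} 1/(2(1 + R₂(P,Q)))`
  where `R₂(P,Q)` is the ratio
  `Δ^{−1} ∫∫_{[0,1]×[0,1]} (P″(x)Q(y) − Δ²P(x)Q″(y))² dx dy / (Q(1)P′(1) + ΔQ′(1)P(1))²`  (32),
  `P` ranges over all polynomials such that `P(0) = P′(0) = 0`, and `Δ` over all real numbers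
  such that `0 < Δ < 1`." "Remark.— Note that we have always `R(P,Q) < 1/2`, which is to be
  expected, since only half of the `L`-functions in question are of a given parity".
* **(33)** (p. 21; `I(Q) := ∫₀¹ Q(y) dy`): "We need to minimize
  `R₂(P,Q) = ∫₀¹ (Δ^{−1}I(Q²)P″(x)² − 2ΔI(QQ″)P″(x)P(x) + Δ³I(Q″²)P(x)²) dx`
  `/ (ΔQ′(1)P(1) + Q(1)P′(1))²`".
* p. 21: "for any `Δ`, `P₀(x) = x²` and `P₁(x) = x² − x³/6` are the correct choices (this leads to
  the `p₀ = 1/4` and `p₁ = 7/16` mentioned in the introduction)" (also footnote 2, p. 7: "if we let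
  `Δ → 1`"); p. 8–9: the Petersson/Weil bound (12) "is sufficient to allow us to take a mollifier of
  length `M = q̂^Δ` for any `Δ < 1/2`", Lemma 3.3 ([VdK2]) "allows one to take any `Δ < 1` and this
  leads to the optimal values of `p_k`"; p. 28: "this is the absolute limit of our method, barring
  any improvement in the (logarithmic) length of the mollifier `Δ` beyond `1` (which would be of
  great significance independently of this, and which is feasible assuming GRH for Dirichlet `L`
  functions as shown by Iwaniec and Sarnak [I-S])".

## What is typed (all over `Polynomial ℝ`, the source's "polynomials `P`, `Q`")

* `unitIntegral R = ∫₀¹ R` (= the source's `I(R)`), `linForm Δ P Q = Q(1)P′(1) + ΔQ′(1)P(1)`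
  (the bracket of (30)), `sqDefect Δ P Q x y = (P″(x)Q(y) − Δ²P(x)Q″(y))²`,
  `offDiagForm Δ P Q = Δ^{−1}∫₀¹∫₀¹ sqDefect` (the second summand of the bracket of (31) = the
  numerator of (32)), `secondMomentForm = linForm² + offDiagForm` (the bracket of (31)),
  `ratio Δ P Q = linForm² / (2 · secondMomentForm)` (`= R(P,Q) = 1/(2(1+R₂))` of Theorem 6.1 when
  `linForm ≠ 0`; the junk value `0` when `linForm = offDiagForm = 0`), `Admissible P :↔ P(0) = 0 ∧
  P′(0) = 0`.
* PROVED: `offDiagForm_eq_expanded` ((32)'s numerator = (33)'s numerator); `offDiagForm_nonneg`,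
  `ratio_le_half` (the Remark after Theorem 6.1, in the form `≤ ½`); for the CENTRAL VALUE case
  `Q = 1` (`k = 0`): `linForm_one`, `offDiagForm_one` (`= Δ^{−1}∫₀¹P″²`), the Cauchy–Schwarz
  envelope `ratio_one_le : ratio Δ P 1 ≤ Δ/(2(1+Δ))` for admissible `P` and `0 < Δ`, attained by
  `P = X²` (`ratio_one_X_sq`), i.e. `sup_P R(P,1) = Δ/(2(1+Δ))` — at `Δ = 1` this is KMV's
  `p₀ = 1/4` of ALL forms (`= ½` of the even forms); the first-derivative value
  `ratio_one_kmvP1 : ratio 1 (X² − X³/6) X = 7/16`; and the EDGE `envelope_lt_quarter_iff :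
  Δ/(2(1+Δ)) < 1/4 ↔ Δ < 1` (`0 ≤ Δ`): inside the printed range `0 < Δ < 1` of Propositions 4.1/5.1
  the one-piece method stays strictly below one quarter of all forms (one half of the even ones) at
  main order, reaching it only in the limit `Δ → 1` — the "½-proportion edge" of the cell's
  KNIFE-EDGES §3 as a statement about the printed functional.

## Design notes

* Profiles are `Polynomial ℝ` as in the source; derivatives are `Polynomial.derivative` (exact),
  integrals are interval integrals `∫ x in (0:ℝ)..1` of polynomial functions (Mathlib
  `intervalIntegral`), evaluated through the fundamental theorem of calculus
  (`unitIntegral_derivative`). The absolute prefactors `ζ(2) q̂^{1/2} (log q̂)^{k−1}/Δ` and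
  `2q̂ ζ(2)² (log q̂)^{2k−2}/Δ²` of (30)–(31) are NOT part of the forms (they cancel in the ratio,
  (32)); they belong to the family-level named facts.
* No `instance`, no `notation`; nothing asserted about modular forms here.

## References

* [KowalskiMichelVanderKam2000] §2 (6)–(9), §3 (12) and Lemma 3.3, Prop. 4.1 (p. 12), Prop. 5.1
  (p. 18), §6 (30)–(32) and Theorem 6.1 (pp. 18–20), §7 (33) and p. 21, §8.4 p. 28.
* [IwaniecSarnak2000] (the squarefree-level twin, `p₀ = 1/4`; not held, acq-11417);
  [IwaniecKowalski2004] Thm. 26.9 / Exercise 26.1 (the same forms at `Δ < ½`, derivative case).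
-/

noncomputable section

open Polynomial intervalIntegral MeasureTheory Set

namespace Literature.NumberTheory.LFunctions.KMV2000

/-! ### The forms -/

/-- `I(R) = ∫₀¹ R(y) dy` for a real polynomial `R` (KMV's `I(Q)`, p. 20).
[cite: KowalskiMichelVanderKam2000, §7 p. 20] -/
def unitIntegral (R : ℝ[X]) : ℝ := ∫ y in (0:ℝ)..1, R.eval y

/-- The LINEAR main-term form of the mollified first moment, the bracket of (30):
`Q(1)P′(1) + Δ Q′(1) P(1)` (`Δ = log M / log q̂` the logarithmic length of the mollifier).
For the central value (`Q = 1`) it is `P′(1)`.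
[cite: KowalskiMichelVanderKam2000, §6 (30)] -/
def linForm (Δ : ℝ) (P Q : ℝ[X]) : ℝ :=
  Q.eval 1 * (derivative P).eval 1 + Δ * (derivative Q).eval 1 * P.eval 1

/-- The integrand of the off-diagonal form: `(P″(x)Q(y) − Δ²P(x)Q″(y))²`.
[cite: KowalskiMichelVanderKam2000, §6 (31)–(32)] -/
def sqDefect (Δ : ℝ) (P Q : ℝ[X]) (x y : ℝ) : ℝ :=
  ((derivative (derivative P)).eval x * Q.eval y
    - Δ ^ 2 * P.eval x * (derivative (derivative Q)).eval y) ^ 2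

/-- The OFF-DIAGONAL (quadratic) main-term form of the mollified second moment, the numerator of
(32): `Δ^{−1} ∫∫_{[0,1]×[0,1]} (P″(x)Q(y) − Δ²P(x)Q″(y))² dx dy`.
[cite: KowalskiMichelVanderKam2000, Theorem 6.1 (32)] -/
def offDiagForm (Δ : ℝ) (P Q : ℝ[X]) : ℝ :=
  Δ⁻¹ * ∫ x in (0:ℝ)..1, ∫ y in (0:ℝ)..1, sqDefect Δ P Q x y

/-- The QUADRATIC main-term form of the mollified second moment, the bracket of (31):
`(Q(1)P′(1) + ΔQ′(1)P(1))² + Δ^{−1}∫∫(P″(x)Q(y) − Δ²P(x)Q″(y))²`.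
[cite: KowalskiMichelVanderKam2000, §6 (31)] -/
def secondMomentForm (Δ : ℝ) (P Q : ℝ[X]) : ℝ :=
  linForm Δ P Q ^ 2 + offDiagForm Δ P Q

/-- KMV's Cauchy–Schwarz ratio `R(P,Q) = (L^h)²/Q^h` at main order
`= linForm² / (2 · secondMomentForm) = 1/(2(1 + R₂(P,Q)))` (Theorem 6.1; the factor `2` is the
quotient of the prefactors of (31) and (30)²). Junk value `0` when `secondMomentForm = 0`.
[cite: KowalskiMichelVanderKam2000, Theorem 6.1] -/
def ratio (Δ : ℝ) (P Q : ℝ[X]) : ℝ :=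
  linForm Δ P Q ^ 2 / (2 * secondMomentForm Δ P Q)

/-- The admissibility condition on the mollifier profile: "`P` ranges over all polynomials such
that `P(0) = P′(0) = 0`". [cite: KowalskiMichelVanderKam2000, Theorem 6.1] -/
def Admissible (P : ℝ[X]) : Prop := P.eval 0 = 0 ∧ (derivative P).eval 0 = 0

/-- The main-order CENTRAL-VALUE envelope `Δ/(2(1+Δ))`: the supremum over admissible `P` of
`R(P,1)` at logarithmic length `Δ` (`ratio_one_le`, `ratio_one_X_sq`); at `Δ = 1` it is KMV's
`p₀ = 1/4` (of all forms; one half of the even forms).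
[cite: KowalskiMichelVanderKam2000, §7 p. 21] -/
def envelope (Δ : ℝ) : ℝ := Δ / (2 * (1 + Δ))

/-! ### Calculus of `unitIntegral` -/

/-- Polynomial functions are interval-integrable. [folklore] -/
private theorem ii (R : ℝ[X]) (a b : ℝ) :
    IntervalIntegrable (fun y : ℝ => R.eval y) volume a b :=
  (Polynomial.continuous R).intervalIntegrable a b

/-- Fundamental theorem of calculus for polynomials on `[0,1]`: `∫₀¹ S′ = S(1) − S(0)`.
[folklore] -/
private theorem unitIntegral_derivative (S : ℝ[X]) :
    unitIntegral (derivative S) = S.eval 1 - S.eval 0 := by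
  unfold unitIntegral
  exact integral_eq_sub_of_hasDerivAt (fun x _ => Polynomial.hasDerivAt S x) (ii _ 0 1)

/-- Additivity of `∫₀¹` on polynomials. [folklore] -/
private theorem unitIntegral_add (R₁ R₂ : ℝ[X]) :
    unitIntegral (R₁ + R₂) = unitIntegral R₁ + unitIntegral R₂ := by
  unfold unitIntegral
  simp only [eval_add]
  exact integral_add (ii R₁ 0 1) (ii R₂ 0 1)

/-- `∫₀¹ (R₁ − R₂) = ∫₀¹ R₁ − ∫₀¹ R₂`. [folklore] -/
private theorem unitIntegral_sub (R₁ R₂ : ℝ[X]) :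
    unitIntegral (R₁ - R₂) = unitIntegral R₁ - unitIntegral R₂ := by
  unfold unitIntegral
  simp only [eval_sub]
  exact integral_sub (ii R₁ 0 1) (ii R₂ 0 1)

/-- `∫₀¹ c·R = c ∫₀¹ R`. [folklore] -/
private theorem unitIntegral_C_mul (c : ℝ) (R : ℝ[X]) :
    unitIntegral (C c * R) = c * unitIntegral R := by
  unfold unitIntegral
  simp only [eval_mul, eval_C]
  exact intervalIntegral.integral_const_mul c _

/-- `∫₀¹ c = c`. [folklore] -/
private theorem unitIntegral_C (c : ℝ) : unitIntegral (C c) = c := by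
  unfold unitIntegral
  simp

/-- `∫₀¹ R ≥ 0` when `R ≥ 0` on `[0,1]`. [folklore] -/
private theorem unitIntegral_nonneg {R : ℝ[X]} (h : ∀ y ∈ Icc (0:ℝ) 1, 0 ≤ R.eval y) :
    0 ≤ unitIntegral R :=
  intervalIntegral.integral_nonneg zero_le_one h

/-- `∫₀¹ R² ≥ 0`. [folklore] -/
private theorem unitIntegral_sq_nonneg (R : ℝ[X]) : 0 ≤ unitIntegral (R ^ 2) :=
  unitIntegral_nonneg fun y _ => by rw [eval_pow]; positivity

/-- **Cauchy–Schwarz on `[0,1]` against the constant `1`**: `(∫₀¹ R)² ≤ ∫₀¹ R²`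
(from `0 ≤ ∫₀¹ (R − c)²` with `c = ∫₀¹ R`). [folklore] -/
private theorem unitIntegral_sq_le (R : ℝ[X]) : unitIntegral R ^ 2 ≤ unitIntegral (R ^ 2) := by
  set c := unitIntegral R with hc
  have h0 : 0 ≤ unitIntegral ((R - C c) ^ 2) := unitIntegral_sq_nonneg _
  have hexp : (R - C c) ^ 2 = R ^ 2 - C (2 * c) * R + C (c ^ 2) := by
    simp only [map_mul, map_pow, C_ofNat]
    ring
  rw [hexp, unitIntegral_add, unitIntegral_sub, unitIntegral_C_mul, unitIntegral_C, ← hc] at h0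
  nlinarith [h0]

/-! ### (32) = (33): expanding the square -/

/-- The inner (`y`-)integral of the off-diagonal form at fixed `x`:
`∫₀¹ (aQ(y) − bQ″(y))² dy = a² I(Q²) − 2ab I(QQ″) + b² I(Q″²)` with `a = P″(x)`, `b = Δ²P(x)`.
[cite: KowalskiMichelVanderKam2000, §7 (33)] -/
theorem integral_sqDefect_inner (Δ : ℝ) (P Q : ℝ[X]) (x : ℝ) :
    ∫ y in (0:ℝ)..1, sqDefect Δ P Q x y =
      (derivative (derivative P)).eval x ^ 2 * unitIntegral (Q ^ 2)
        - 2 * ((derivative (derivative P)).eval x * (Δ ^ 2 * P.eval x))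
            * unitIntegral (Q * derivative (derivative Q))
        + (Δ ^ 2 * P.eval x) ^ 2 * unitIntegral (derivative (derivative Q) ^ 2) := by
  set a := (derivative (derivative P)).eval x
  set b := Δ ^ 2 * P.eval x
  set Q₂ := derivative (derivative Q)
  have hpt : ∀ y, sqDefect Δ P Q x y =
      (C (a ^ 2) * Q ^ 2 - C (2 * (a * b)) * (Q * Q₂) + C (b ^ 2) * Q₂ ^ 2).eval y := by
    intro y
    simp only [sqDefect, eval_add, eval_sub, eval_mul, eval_C, eval_pow, a, b, Q₂]
    ring
  simp_rw [hpt]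
  change unitIntegral _ = _
  rw [unitIntegral_add, unitIntegral_sub, unitIntegral_C_mul, unitIntegral_C_mul,
    unitIntegral_C_mul]

/-- **(32) = (33).** The off-diagonal form in expanded shape:
`Δ^{−1}∫∫(P″Q − Δ²PQ″)² = Δ^{−1}I(Q²)∫₀¹P″² − 2ΔI(QQ″)∫₀¹P″P + Δ³I(Q″²)∫₀¹P²`
(for `Δ ≠ 0`; the source's "Remarking the equalities …" step read backwards).
[cite: KowalskiMichelVanderKam2000, §6 (31)–(32) and §7 (33)] -/
theorem offDiagForm_eq_expanded {Δ : ℝ} (hΔ : Δ ≠ 0) (P Q : ℝ[X]) :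
    offDiagForm Δ P Q =
      Δ⁻¹ * unitIntegral (Q ^ 2) * unitIntegral (derivative (derivative P) ^ 2)
        - 2 * Δ * unitIntegral (Q * derivative (derivative Q))
            * unitIntegral (derivative (derivative P) * P)
        + Δ ^ 3 * unitIntegral (derivative (derivative Q) ^ 2) * unitIntegral (P ^ 2) := by
  unfold offDiagForm
  simp_rw [integral_sqDefect_inner]
  set I₁ := unitIntegral (Q ^ 2)
  set I₂ := unitIntegral (Q * derivative (derivative Q))
  set I₃ := unitIntegral (derivative (derivative Q) ^ 2)
  set P₂ := derivative (derivative P)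
  have hpt : ∀ x : ℝ, P₂.eval x ^ 2 * I₁ - 2 * (P₂.eval x * (Δ ^ 2 * P.eval x)) * I₂
        + (Δ ^ 2 * P.eval x) ^ 2 * I₃ =
      (C I₁ * P₂ ^ 2 - C (2 * Δ ^ 2 * I₂) * (P₂ * P) + C (Δ ^ 4 * I₃) * P ^ 2).eval x := by
    intro x
    simp only [eval_add, eval_sub, eval_mul, eval_C, eval_pow]
    ring
  simp_rw [hpt]
  change Δ⁻¹ * unitIntegral _ = _
  rw [unitIntegral_add, unitIntegral_sub, unitIntegral_C_mul, unitIntegral_C_mul,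
    unitIntegral_C_mul]
  have hΔ2 : Δ⁻¹ * Δ ^ 2 = Δ := by
    rw [pow_two, ← mul_assoc, inv_mul_cancel₀ hΔ, one_mul]
  have hΔ4 : Δ⁻¹ * Δ ^ 4 = Δ ^ 3 := by
    rw [show Δ ^ 4 = Δ * Δ ^ 3 by ring, ← mul_assoc, inv_mul_cancel₀ hΔ, one_mul]
  linear_combination (-2 * I₂ * unitIntegral (P₂ * P)) * hΔ2
    + (I₃ * unitIntegral (P ^ 2)) * hΔ4

/-! ### Signs and the Remark `R(P,Q) ≤ ½` -/

/-- The off-diagonal form is non-negative for `Δ ≥ 0` (a double integral of a square).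
[cite: KowalskiMichelVanderKam2000, Theorem 6.1 (32)] -/
theorem offDiagForm_nonneg {Δ : ℝ} (hΔ : 0 ≤ Δ) (P Q : ℝ[X]) : 0 ≤ offDiagForm Δ P Q := by
  unfold offDiagForm
  refine mul_nonneg (inv_nonneg.mpr hΔ) ?_
  refine intervalIntegral.integral_nonneg zero_le_one fun x _ => ?_
  exact intervalIntegral.integral_nonneg zero_le_one fun y _ => by unfold sqDefect; positivity

/-- The bracket of (31) is non-negative for `Δ ≥ 0`.
[cite: KowalskiMichelVanderKam2000, §6 (31)] -/
theorem secondMomentForm_nonneg {Δ : ℝ} (hΔ : 0 ≤ Δ) (P Q : ℝ[X]) :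
    0 ≤ secondMomentForm Δ P Q := by
  unfold secondMomentForm
  have := offDiagForm_nonneg hΔ P Q
  positivity

/-- **Remark after Theorem 6.1**: "we have always `R(P,Q) < 1/2` … since only half of the
`L`-functions in question are of a given parity" — here in the form `R(P,Q) ≤ ½` for `Δ ≥ 0`
(strict as soon as the off-diagonal form is positive, `ratio_lt_half`).
[cite: KowalskiMichelVanderKam2000, Theorem 6.1, Remark] -/
theorem ratio_le_half {Δ : ℝ} (hΔ : 0 ≤ Δ) (P Q : ℝ[X]) : ratio Δ P Q ≤ 1 / 2 := by
  unfold ratio secondMomentForm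
  have hO := offDiagForm_nonneg hΔ P Q
  set L := linForm Δ P Q
  set O := offDiagForm Δ P Q
  rcases eq_or_lt_of_le (add_nonneg (sq_nonneg L) hO) with h0 | hpos
  · rw [← h0]; norm_num
  · rw [div_le_iff₀ (by positivity)]
    nlinarith

/-- "We have always `R(P,Q) < 1/2`": strict form, whenever the off-diagonal form is positive.
[cite: KowalskiMichelVanderKam2000, Theorem 6.1, Remark] -/
theorem ratio_lt_half {Δ : ℝ} (P Q : ℝ[X]) (hO : 0 < offDiagForm Δ P Q) :
    ratio Δ P Q < 1 / 2 := by
  unfold ratio secondMomentForm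
  set L := linForm Δ P Q
  set O := offDiagForm Δ P Q
  rw [div_lt_iff₀ (by positivity)]
  nlinarith [sq_nonneg L]

/-- `R(P,Q) ≥ 0` for `Δ ≥ 0`. [cite: KowalskiMichelVanderKam2000, Theorem 6.1] -/
theorem ratio_nonneg {Δ : ℝ} (hΔ : 0 ≤ Δ) (P Q : ℝ[X]) : 0 ≤ ratio Δ P Q := by
  unfold ratio
  have := secondMomentForm_nonneg hΔ P Q
  positivity

/-! ### The central-value case `Q = 1` (`k = 0`) -/

/-- For `Q = 1`: `linForm Δ P 1 = P′(1)`. [cite: KowalskiMichelVanderKam2000, §6 (30)] -/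
theorem linForm_one (Δ : ℝ) (P : ℝ[X]) : linForm Δ P 1 = (derivative P).eval 1 := by
  simp [linForm]

/-- For `Q = 1`: `offDiagForm Δ P 1 = Δ^{−1} ∫₀¹ P″(x)² dx`.
[cite: KowalskiMichelVanderKam2000, Theorem 6.1 (32)] -/
theorem offDiagForm_one (Δ : ℝ) (P : ℝ[X]) :
    offDiagForm Δ P 1 = Δ⁻¹ * unitIntegral (derivative (derivative P) ^ 2) := by
  unfold offDiagForm unitIntegral
  congr 1
  refine intervalIntegral.integral_congr fun x _ => ?_
  simp [sqDefect, eval_pow]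

/-- **The Cauchy–Schwarz envelope for central values.** For an admissible profile
(`P(0) = P′(0) = 0`) and `0 < Δ`: `R(P,1) ≤ Δ/(2(1+Δ))`. Proof: `∫₀¹P″² ≥ (∫₀¹P″)² = P′(1)²`.
With `ratio_one_X_sq` this identifies `Max_P R(P,1)` of Theorem 6.1 at fixed `Δ` as
`Δ/(2(1+Δ))` (KMV p. 21: "for any `Δ`, `P₀(x) = x²` … [is] the correct choice").
[cite: KowalskiMichelVanderKam2000, Theorem 6.1 and §7 p. 21] -/
theorem ratio_one_le {Δ : ℝ} (hΔ : 0 < Δ) {P : ℝ[X]} (hP : Admissible P) :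
    ratio Δ P 1 ≤ envelope Δ := by
  unfold ratio secondMomentForm envelope
  rw [linForm_one, offDiagForm_one]
  set a := (derivative P).eval 1
  set J := unitIntegral (derivative (derivative P) ^ 2)
  -- Cauchy–Schwarz: `a² ≤ J`, using `∫₀¹ P″ = P′(1) − P′(0) = a`.
  have hint : unitIntegral (derivative (derivative P)) = a := by
    rw [unitIntegral_derivative, hP.2, sub_zero]
  have hCS : a ^ 2 ≤ J := by
    have := unitIntegral_sq_le (derivative (derivative P))
    rwa [hint] at this
  have hJ : 0 ≤ J := unitIntegral_sq_nonneg _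
  rcases eq_or_lt_of_le (sq_nonneg a) with ha | ha
  · -- `a = 0`: the ratio is `0`.
    rw [← ha]
    simp only [zero_add, zero_div]
    positivity
  · rw [div_le_div_iff₀ (by positivity) (by positivity)]
    have hΔinv : Δ⁻¹ * J ≥ Δ⁻¹ * a ^ 2 := mul_le_mul_of_nonneg_left hCS (le_of_lt (inv_pos.mpr hΔ))
    have : a ^ 2 * (2 * (1 + Δ)) = 2 * (a ^ 2 + Δ⁻¹ * a ^ 2) * Δ := by
      field_simp
      ring
    rw [this]
    have h2 : 2 * (a ^ 2 + Δ⁻¹ * a ^ 2) * Δ ≤ 2 * (a ^ 2 + Δ⁻¹ * J) * Δ := by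
      have : a ^ 2 + Δ⁻¹ * a ^ 2 ≤ a ^ 2 + Δ⁻¹ * J := by linarith
      nlinarith
    linarith [h2, mul_comm Δ (2 * (a ^ 2 + Δ⁻¹ * J))]

/-- `∫₀¹ ((X²)″)² = 4`. [folklore] -/
private theorem unitIntegral_X_sq_dd :
    unitIntegral (derivative (derivative (X ^ 2 : ℝ[X])) ^ 2) = 4 := by
  have h : derivative (derivative (X ^ 2 : ℝ[X])) ^ 2 = C 4 := by
    rw [derivative_X_sq, derivative_C_mul, derivative_X, mul_one, ← map_pow]
    norm_num
  rw [h, unitIntegral_C]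

/-- **The optimal central-value profile `P₀ = x²`** attains the envelope:
`R(x², 1) = Δ/(2(1+Δ))` for `0 < Δ`; at `Δ = 1` this is `1/4` = KMV's `p₀`
("the choices `P = x²`, for `k = 0` … give again the non-vanishing proportion `p₀ ≥ 1/4` … if we
let `Δ → 1`", footnote 2 p. 7). [cite: KowalskiMichelVanderKam2000, §7 p. 21; §2 footnote 2] -/
theorem ratio_one_X_sq {Δ : ℝ} (hΔ : 0 < Δ) : ratio Δ (X ^ 2) 1 = envelope Δ := by
  unfold ratio secondMomentForm envelope
  rw [linForm_one, offDiagForm_one, unitIntegral_X_sq_dd, derivative_X_sq]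
  simp only [eval_mul, eval_C, eval_X, mul_one]
  field_simp
  ring

/-- `P₀ = x²` is admissible (`P(0) = P′(0) = 0`). [cite: KowalskiMichelVanderKam2000, §7 p. 21] -/
theorem admissible_X_sq : Admissible (X ^ 2 : ℝ[X]) := by
  constructor <;> simp

/-- `p₀ = 1/4`: at the end `Δ = 1` of the printed range the optimal one-piece mollifier gives one
quarter of all forms, i.e. one half of the even forms (Iwaniec–Sarnak's "50 %").
[cite: KowalskiMichelVanderKam2000, §1 Theorem 1.1 ("`p₀ ≥ 1/4`") and §7 p. 21] -/
theorem ratio_one_X_sq_at_one : ratio 1 (X ^ 2) 1 = 1 / 4 := by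
  rw [ratio_one_X_sq one_pos, envelope]; norm_num

/-! ### The first derivative: `P₁ = x² − x³/6`, `Q = y`, `Δ = 1` gives `7/16` -/

/-- KMV's optimal profile for the first derivative, `P₁(x) = x² − x³/6`.
[cite: KowalskiMichelVanderKam2000, §7 p. 21] -/
def kmvP1 : ℝ[X] := X ^ 2 - C (1 / 6) * X ^ 3

/-- `P₁ = x² − x³/6` is admissible (`P(0) = P′(0) = 0`).
[cite: KowalskiMichelVanderKam2000, §7 p. 21] -/
theorem admissible_kmvP1 : Admissible kmvP1 := by
  constructor <;> simp [kmvP1]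

/-- `P₁′ = 2x − x²/2`. [folklore] -/
private theorem derivative_kmvP1 : derivative kmvP1 = C 2 * X - C (1 / 2) * X ^ 2 := by
  simp only [kmvP1, derivative_sub, derivative_C_mul, derivative_X_pow]
  norm_num
  rw [← mul_assoc, ← map_mul]
  norm_num

/-- `P₁″ = 2 − x`. [folklore] -/
private theorem derivative2_kmvP1 : derivative (derivative kmvP1) = C 2 - X := by
  rw [derivative_kmvP1]
  simp only [derivative_sub, derivative_C_mul, derivative_X, derivative_X_sq, mul_one]
  rw [← mul_assoc, ← map_mul]
  norm_num

/-- `∫₀¹ (2 − x)² dx = ∫₁² x² dx = 7/3`. [folklore] -/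
private theorem unitIntegral_two_sub_X_sq : unitIntegral ((C 2 - X) ^ 2 : ℝ[X]) = 7 / 3 := by
  unfold unitIntegral
  simp only [eval_pow, eval_sub, eval_C, eval_X]
  have h := intervalIntegral.integral_comp_sub_left (f := fun y : ℝ => y ^ 2) (a := 0) (b := 1)
    (2 : ℝ)
  rw [h]
  norm_num [integral_pow]

/-- `∫₀¹ y² dy = 1/3`. [folklore] -/
private theorem unitIntegral_X_sq : unitIntegral (X ^ 2 : ℝ[X]) = 1 / 3 := by
  unfold unitIntegral
  simp only [eval_pow, eval_X]
  norm_num [integral_pow]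

/-- `∫₀¹ 0 = 0`. [folklore] -/
private theorem unitIntegral_zero : unitIntegral (0 : ℝ[X]) = 0 := by
  simpa using unitIntegral_C 0

/-- **`p₁ = 7/16`.** With `P₁ = x² − x³/6`, `Q = y` and `Δ = 1`: `R(P₁, y) = 7/16`
(`linForm = 3/2 + 5/6 = 7/3`, `offDiagForm = I(y²)·∫₀¹(2−x)² = (1/3)(7/3) = 7/9`, `R₂ = 1/7`).
[cite: KowalskiMichelVanderKam2000, §1 Theorem 1.1 ("`p₁ ≥ 7/16`"), §7 p. 21] -/
theorem ratio_one_kmvP1 : ratio 1 kmvP1 X = 7 / 16 := by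
  have hlin : linForm 1 kmvP1 X = 7 / 3 := by
    simp only [linForm, kmvP1, eval_X, derivative_X, eval_one, eval_sub,
      eval_mul, eval_C, eval_pow, one_pow, mul_one, one_mul, derivative_sub, derivative_C_mul,
      derivative_X_pow]
    norm_num
  have hoff : offDiagForm 1 kmvP1 X = 7 / 9 := by
    rw [offDiagForm_eq_expanded one_ne_zero, derivative2_kmvP1, derivative_X, derivative_one]
    simp only [mul_zero, ne_eq, OfNat.ofNat_ne_zero, not_false_eq_true, zero_pow,
      unitIntegral_zero, unitIntegral_X_sq, unitIntegral_two_sub_X_sq, inv_one, one_pow, one_mul,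
      mul_one, zero_mul, sub_zero, add_zero]
    norm_num
  unfold ratio secondMomentForm
  rw [hlin, hoff]
  norm_num

/-! ### The edge `Δ = 1` -/

/-- **The ½-proportion edge at main order.** For `0 ≤ Δ`: `Δ/(2(1+Δ)) < 1/4 ↔ Δ < 1` — inside
the printed range `0 < Δ < 1` (Propositions 4.1/5.1: Petersson + Weil give `Δ < ½`, VanderKam's
Lemma 3.3 gives `Δ < 1`) the best one-piece proportion stays strictly below one quarter of all
forms = one half of the even forms; KMV p. 28: "this is the absolute limit of our method, barring
any improvement in the (logarithmic) length of the mollifier `Δ` beyond `1` (which would be of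
great significance …)". [cite: KowalskiMichelVanderKam2000, §8.4 p. 28; Theorem 6.1] -/
theorem envelope_lt_quarter_iff {Δ : ℝ} (hΔ : 0 ≤ Δ) : envelope Δ < 1 / 4 ↔ Δ < 1 := by
  unfold envelope
  rw [div_lt_iff₀ (by positivity)]
  constructor <;> intro h <;> linarith

/-- `Δ/(2(1+Δ)) = 1/4 ↔ Δ = 1` (`0 ≤ Δ`): one quarter of all forms is reached exactly at the
endpoint `Δ = 1` ("`p₀ ≥ 1/4` … if we let `Δ → 1`", footnote 2).
[cite: KowalskiMichelVanderKam2000, §2 footnote 2; §8.4 p. 28] -/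
theorem envelope_eq_quarter_iff {Δ : ℝ} (hΔ : 0 ≤ Δ) : envelope Δ = 1 / 4 ↔ Δ = 1 := by
  unfold envelope
  rw [div_eq_iff (by positivity)]
  constructor <;> intro h <;> linarith

/-- The envelope `Δ ↦ Δ/(2(1+Δ))` is strictly increasing in the length `Δ ≥ 0` ("To take a
longer mollifier requires greater cancellation", p. 8).
[cite: KowalskiMichelVanderKam2000, §3 p. 8 and Theorem 6.1] -/
theorem envelope_strictMonoOn : StrictMonoOn envelope (Ici 0) := by
  intro a ha b hb hab
  simp only [mem_Ici] at ha hb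
  unfold envelope
  rw [div_lt_div_iff₀ (by positivity) (by positivity)]
  nlinarith

/-- `Δ/(2(1+Δ)) < 1/2` for every `Δ ≥ 0` (the parity bound of the Remark after Theorem 6.1, at
the optimum). [cite: KowalskiMichelVanderKam2000, Theorem 6.1, Remark] -/
theorem envelope_lt_half {Δ : ℝ} (hΔ : 0 ≤ Δ) : envelope Δ < 1 / 2 := by
  unfold envelope
  rw [div_lt_iff₀ (by positivity)]
  linarith

/-- The central-value proportion of every admissible one-piece profile at any `0 < Δ < 1` is
`< 1/4` of all forms (`< 1/2` of the even ones) at main order.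
[cite: KowalskiMichelVanderKam2000, Theorem 6.1 and §8.4 p. 28] -/
theorem ratio_one_lt_quarter {Δ : ℝ} (hΔ : 0 < Δ) (hΔ1 : Δ < 1) {P : ℝ[X]} (hP : Admissible P) :
    ratio Δ P 1 < 1 / 4 :=
  (ratio_one_le hΔ hP).trans_lt ((envelope_lt_quarter_iff hΔ.le).mpr hΔ1)

end Literature.NumberTheory.LFunctions.KMV2000
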